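import Summits.HodgeConjecture.HodgeCM.StubTree.PairingReduction_1

/-! PORT of `HodgeCM/StubTree/PairingReduction.lean` (HodgeCMPerL run 82) — part 2: continuation of `Summits.HodgeConjecture.HodgeCM.StubTree.PairingReduction_1` (split at a top-level declaration boundary by port_pkg.py; scope re-opened below; declarations unchanged). -/

-- port_pkg: scope re-opened for this part (file-level context, then the namespace/section stack open at the cut)
noncomputable section
open scoped TensorProduct BigOperators
namespace HodgeCM
namespace Universe
open Literature.AlgebraicGeometry.Motives
open Literature.AlgebraicGeometry.Motives.HodgeStructure (conj conj_baseChange conj_smul conj_tmul mem_piece_iff)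
variable (U : Universe)
variable {U}
variable (U)
namespace IsoDatum
variable {U} {L : CMField} {ι₁ : L →+* ℂ} {V : HermSpace3 L ι₁} (D : U.IsoDatum V) (Hk : U.HeckeData)
variable {D}
/-- `⟨e_π x, y⟩ = ⟨e_π x, e_π y⟩` on `H^{2,0}`. -/
theorem pair2_proj_left (hd : D.Decomp) (ho : D.Ortho) (Γ : Level V) (π : D.A)
    {x y : U.CohC (U.pms L ι₁ V Γ) 2} (hx : x ∈ U.F2 Γ) (hy : y ∈ U.F2 Γ) :
    U.pair2 _ (D.proj Γ π x) y = U.pair2 _ (D.proj Γ π x) (D.proj Γ π y) := by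
  classical
  obtain ⟨s, hs0, hsum⟩ := hd Γ y hy
  conv_lhs => rw [hsum]
  rw [pair2_sum_right]
  rw [Finset.sum_eq_single π]
  · intro π' _ hne
    exact ho Γ π π' x y hx hy (Ne.symm hne)
  · intro hπ
    rw [hs0 π hπ, pair2_zero_right]

/-- `⟨x, e_π y⟩ = ⟨e_π x, e_π y⟩` on `H^{2,0}`. -/
theorem pair2_proj_right (hd : D.Decomp) (ho : D.Ortho) (Γ : Level V) (π : D.A)
    {x y : U.CohC (U.pms L ι₁ V Γ) 2} (hx : x ∈ U.F2 Γ) (hy : y ∈ U.F2 Γ) :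
    U.pair2 _ x (D.proj Γ π y) = U.pair2 _ (D.proj Γ π x) (D.proj Γ π y) := by
  classical
  obtain ⟨s, hs0, hsum⟩ := hd Γ x hx
  conv_lhs => rw [hsum]
  rw [pair2_sum_left]
  rw [Finset.sum_eq_single π]
  · intro π' _ hne
    exact ho Γ π' π x y hx hy hne
  · intro hπ
    rw [hs0 π hπ, pair2_zero_left]

/-- Self-adjointness: `⟨e_π x, y⟩ = ⟨x, e_π y⟩` on `H^{2,0}`. -/
theorem pair2_proj_comm (hd : D.Decomp) (ho : D.Ortho) (Γ : Level V) (π : D.A)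
    {x y : U.CohC (U.pms L ι₁ V Γ) 2} (hx : x ∈ U.F2 Γ) (hy : y ∈ U.F2 Γ) :
    U.pair2 _ (D.proj Γ π x) y = U.pair2 _ x (D.proj Γ π y) := by
  rw [pair2_proj_left hd ho Γ π hx hy, pair2_proj_right hd ho Γ π hx hy]

/-- A nonzero `H^{2,0}`-class has a nonzero isotypic component. -/
theorem exists_proj_ne_zero (hd : D.Decomp) (Γ : Level V) {c : U.CohC (U.pms L ι₁ V Γ) 2} (hc : c ∈ U.F2 Γ)
    (hne : c ≠ 0) : ∃ π : D.A, D.proj Γ π c ≠ 0 := by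
  obtain ⟨s, -, hsum⟩ := hd Γ c hc
  by_contra h
  have h' : ∀ p : D.A, D.proj Γ p c = 0 := fun p => not_not.mp (not_exists.mp h p)
  exact hne (hsum.trans (Finset.sum_eq_zero fun p _ => h' p))

/-! #### Kernel: (P) from the standard package and the obstruction -/

variable (D) {Hk}

/-- **Core of the reduction.**  A wedge `ω₀ ∪ ω₁` of isotypic one-forms with a nonzero component in a constituent `π` that
is met by `(Ψ₂,Ψ₃)`-wedges pairs, after pull-back along ONE morphism, with a `(Ψ₂,Ψ₃)`-wedge: project both wedges to `π`;
translate inside `π` until they pair (I5); un-project the right slot by self-adjointness (I1)–(I3) and equivariance (I4);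
un-project the left slot by expanding `e_π` into Hecke correspondences (I6) — one term of the sum is a nonzero pull–pull
pairing, i.e. a nonzero period `∫ h^*ω₀ ∧ h^*ω₁ ∧ \overline{g^*ω₂ ∧ g^*ω₃}` (`period_eq_pair2`, `pull_cup`, `pull_comp`). -/
theorem exists_period_ne_zero (M : U.ModelAxioms) (hS : D.Standard Hk) {K : CMField} {Ψa Ψb Ψ₂ Ψ₃ : CMType K}
    {σ : K →+* ℂ} {Γ : Level V} {ω₀ ω₁ : U.CohC (U.pms L ι₁ V Γ) 1} (h₀ : ω₀ ∈ U.Uiso Γ K Ψa σ)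
    (h₁ : ω₁ ∈ U.Uiso Γ K Ψb σ) {π : D.A} (hπc : D.proj Γ π (U.cup2C (U.pms L ι₁ V Γ) 1 ω₀ ω₁) ≠ 0)
    (hm : D.Meets π K Ψ₂ Ψ₃ σ) :
    ∃ (Γ' : Level V) (h : U.Mor (U.pms L ι₁ V Γ') (U.pms L ι₁ V Γ)) (ω : Fin 4 → U.CohC (U.pms L ι₁ V Γ') 1),
      ω 0 = U.pullC h 1 ω₀ ∧ ω 1 = U.pullC h 1 ω₁ ∧
      ω 2 ∈ U.Uiso Γ' K Ψ₂ σ ∧ ω 3 ∈ U.Uiso Γ' K Ψ₃ σ ∧ U.period (U.pms L ι₁ V Γ') ω ≠ 0 := by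
  have hH := M.pull_hodge
  -- the given wedge and its F²-membership
  have hcF : U.cup2C _ 1 ω₀ ω₁ ∈ U.F2 Γ :=
    cup2C_mem_F2' M.cup2_hodge _ (Uiso_le_H10 hH Γ K Ψa σ h₀) (Uiso_le_H10 hH Γ K Ψb σ h₁)
  -- a (Ψ₂,Ψ₃)-wedge meeting π
  obtain ⟨Γ', ω₂, ω₃, h₂, h₃, hπw⟩ := hm
  have hwF : U.cup2C _ 1 ω₂ ω₃ ∈ U.F2 Γ' :=
    cup2C_mem_F2' M.cup2_hodge _ (Uiso_le_H10 hH Γ' K Ψ₂ σ h₂) (Uiso_le_H10 hH Γ' K Ψ₃ σ h₃)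
  set c := U.cup2C _ 1 ω₀ ω₁ with hc_def
  set w := U.cup2C _ 1 ω₂ ω₃ with hw_def
  have hcπF : D.proj Γ π c ∈ U.F2 Γ := hS.projMem Γ π c hcF
  have hdF : D.proj Γ' π w ∈ U.F2 Γ' := hS.projMem Γ' π w hwF
  -- (I5): translates of the two π-components pair non-trivially at a common level
  obtain ⟨Γ'', F, hF, G, hG, hpair⟩ := hS.translate π Γ Γ' (D.proj Γ π c) (D.proj Γ' π w) hcπF hdF
    (hS.idem Γ π c hcF) (hS.idem Γ' π w hwF) hπc hπw
  have hxF : U.pullC F 2 (D.proj Γ π c) ∈ U.F2 Γ'' := pullC_mem_F2 hH F hcπF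
  have hyF : U.pullC G 2 w ∈ U.F2 Γ'' := pullC_mem_F2 hH G hwF
  have hFcF : U.pullC F 2 c ∈ U.F2 Γ'' := pullC_mem_F2 hH F hcF
  -- un-project the right slot: ⟨F^* c_π, G^* w⟩ = ⟨F^* c_π, G^* w_π⟩ ≠ 0
  have hxfix : D.proj Γ'' π (U.pullC F 2 (D.proj Γ π c)) = U.pullC F 2 (D.proj Γ π c) := by
    rw [hS.equivar Γ Γ'' F hF π _ hcπF, hS.idem Γ π c hcF]
  have key1 : U.pair2 _ (U.pullC F 2 (D.proj Γ π c)) (U.pullC G 2 w) ≠ 0 := by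
    rw [← hxfix, pair2_proj_comm hS.decomp hS.ortho Γ'' π hxF hyF, hS.equivar Γ' Γ'' G hG π w hwF]
    exact hpair
  -- un-project the left slot: expand the projector into Hecke correspondences (I6)
  have e1 : U.pullC F 2 (D.proj Γ π c) = D.proj Γ'' π (U.pullC F 2 c) :=
    (hS.equivar Γ Γ'' F hF π c hcF).symm
  obtain ⟨n, Γk, f, g, coef, hexp⟩ := hS.expand π Γ''
  have hsum : ∑ k, coef k * U.pair2 _ (U.pullC (f k) 2 (U.pullC F 2 c)) (U.pullC (g k) 2 (U.pullC G 2 w)) ≠ 0 := by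
    rw [← hexp _ _ hFcF hyF, ← e1]
    exact key1
  obtain ⟨k, -, hk⟩ := Finset.exists_ne_zero_of_sum_ne_zero hsum
  have hk' : U.pair2 _ (U.pullC (f k) 2 (U.pullC F 2 c)) (U.pullC (g k) 2 (U.pullC G 2 w)) ≠ 0 := by
    intro h0
    exact hk (by rw [h0, mul_zero])
  -- assemble: h := F ∘ f_k for the given wedge, G ∘ g_k for the (Ψ₂,Ψ₃)-wedge
  let ω : Fin 4 → U.CohC (U.pms L ι₁ V (Γk k)) 1 := fun i =>
    match i with
    | 0 => U.pullC (U.comp (f k) F) 1 ω₀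
    | 1 => U.pullC (U.comp (f k) F) 1 ω₁
    | 2 => U.pullC (U.comp (g k) G) 1 ω₂
    | 3 => U.pullC (U.comp (g k) G) 1 ω₃
  refine ⟨Γk k, U.comp (f k) F, ω, rfl, rfl, pullC_mem_Uiso M.pull_comp _ K Ψ₂ σ h₂,
    pullC_mem_Uiso M.pull_comp _ K Ψ₃ σ h₃, ?_⟩
  rw [period_eq_pair2]
  show U.pair2 _ (U.cup2C _ 1 (U.pullC (U.comp (f k) F) 1 ω₀) (U.pullC (U.comp (f k) F) 1 ω₁))
    (U.cup2C _ 1 (U.pullC (U.comp (g k) G) 1 ω₂) (U.pullC (U.comp (g k) G) 1 ω₃)) ≠ 0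
  rw [← pullC_cup2C M.pull_cup, ← pullC_cup2C M.pull_cup, pullC_comp_apply M.pull_comp,
    pullC_comp_apply M.pull_comp]
  exact hk'

/-- **(P) from the print-interface package (I0)–(I6) and THE OBSTRUCTION (P♮).** -/
theorem pairingAt_of_obstruction (M : U.ModelAxioms) (hS : D.Standard Hk) {K : CMField} {Ψ : Fin 4 → CMType K}
    {σ : K →+* ℂ} (hO : D.Obstruction K Ψ σ) : U.PairingAt V K Ψ σ := by
  intro Γ ω₀ ω₁ h₀ h₁ hne
  obtain ⟨π, hπc, hm⟩ := hO Γ ω₀ ω₁ h₀ h₁ hne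
  exact D.exists_period_ne_zero M hS h₀ h₁ hπc hm

/-- **(P♯₂) from the print-interface package (I0)–(I6) and the free obstruction (P♮₂)** (gen 2's `FreePairing2At`, the
piece its Venkataramana-free assembly `periodNV_of_supplyEach01_freePairing2` consumes). -/
theorem freePairing2At_of_freeObstruction (M : U.ModelAxioms) (hS : D.Standard Hk) {K : CMField}
    {Ψ : Fin 4 → CMType K} {σ : K →+* ℂ} (hO : D.FreeObstruction K Ψ σ) : U.FreePairing2At V K Ψ σ := by
  intro Γ₀ Γ₁ ω₀ ω₁ h₀ h₁ hne₀ hne₁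
  obtain ⟨Γ', f₀, f₁, π, hπc, hm⟩ := hO Γ₀ Γ₁ ω₀ ω₁ h₀ h₁ hne₀ hne₁
  obtain ⟨Γ'', h, ω, e0, e1, h2, h3, hper⟩ := D.exists_period_ne_zero M hS
    (pullC_mem_Uiso M.pull_comp f₀ K (Ψ 0) σ h₀) (pullC_mem_Uiso M.pull_comp f₁ K (Ψ 1) σ h₁) hπc hm
  refine ⟨Γ'', U.comp h f₀, U.comp h f₁, ω, ?_, ?_, h2, h3, hper⟩
  · rw [e0, pullC_comp_apply M.pull_comp]
  · rw [e1, pullC_comp_apply M.pull_comp]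

/-- (V₂) ∧ (P♮) ⇒ (P♮₂): Venkataramana's theorem makes some pair of translates wedge non-trivially, and (P♮) applies
at that level (pull-backs of isotypic forms are isotypic, `Fact_pull_comp`). -/
theorem freeObstruction_of_virtualCup_obstruction (hc : U.Fact_pull_comp) (hV : U.VirtualCup11₂ V) {K : CMField}
    {Ψ : Fin 4 → CMType K} {σ : K →+* ℂ} (hO : D.Obstruction K Ψ σ) : D.FreeObstruction K Ψ σ := by
  intro Γ₀ Γ₁ ω₀ ω₁ h₀ h₁ hne₀ hne₁
  obtain ⟨Γ', f₀, f₁, hcup⟩ := hV Γ₀ Γ₁ ω₀ ω₁ hne₀ hne₁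
  obtain ⟨π, hπc, hm⟩ := hO Γ' _ _ (pullC_mem_Uiso hc f₀ K (Ψ 0) σ h₀) (pullC_mem_Uiso hc f₁ K (Ψ 1) σ h₁) hcup
  exact ⟨Γ', f₀, f₁, π, hπc, hm⟩

/-- **Honesty: (P) ⇒ (P♮)** over the standard package with equivariance for all morphisms (I4♯) — so, given the PRINT
structure, THE OBSTRUCTION is not only sufficient but necessary. -/
theorem obstruction_of_pairingAt (M : U.ModelAxioms) (hS : D.Standard Hk) (hE : D.EquivarAll) {K : CMField}
    {Ψ : Fin 4 → CMType K} {σ : K →+* ℂ} (hP : U.PairingAt V K Ψ σ) : D.Obstruction K Ψ σ := by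
  classical
  intro Γ ω₀ ω₁ h₀ h₁ hne
  have hH := M.pull_hodge
  obtain ⟨Γ', h, ω, e0, e1, h2, h3, hper⟩ := hP Γ ω₀ ω₁ h₀ h₁ hne
  rw [period_eq_pair2, e0, e1, ← pullC_cup2C M.pull_cup] at hper
  set c := U.cup2C _ 1 ω₀ ω₁ with hc_def
  set y := U.cup2C _ 1 (ω 2) (ω 3) with hy_def
  have hcF : c ∈ U.F2 Γ :=
    cup2C_mem_F2' M.cup2_hodge _ (Uiso_le_H10 hH Γ K (Ψ 0) σ h₀) (Uiso_le_H10 hH Γ K (Ψ 1) σ h₁)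
  have hxF : U.pullC h 2 c ∈ U.F2 Γ' := pullC_mem_F2 hH h hcF
  have hyF : y ∈ U.F2 Γ' :=
    cup2C_mem_F2' M.cup2_hodge _ (Uiso_le_H10 hH Γ' K (Ψ 2) σ h2) (Uiso_le_H10 hH Γ' K (Ψ 3) σ h3)
  obtain ⟨s, -, hsum⟩ := hS.decomp Γ' _ hxF
  have hper' : ∑ π ∈ s, U.pair2 _ (D.proj Γ' π (U.pullC h 2 c)) (D.proj Γ' π y) ≠ 0 := by
    have : U.pair2 _ (U.pullC h 2 c) y = ∑ π ∈ s, U.pair2 _ (D.proj Γ' π (U.pullC h 2 c)) (D.proj Γ' π y) := by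
      conv_lhs => rw [hsum]
      rw [pair2_sum_left]
      exact Finset.sum_congr rfl fun π _ => pair2_proj_left hS.decomp hS.ortho Γ' π hxF hyF
    rw [← this]
    exact hper
  obtain ⟨π, -, hπ⟩ := Finset.exists_ne_zero_of_sum_ne_zero hper'
  have hx0 : D.proj Γ' π (U.pullC h 2 c) ≠ 0 := by
    intro h0; exact hπ (by rw [h0, pair2_zero_left])
  have hy0 : D.proj Γ' π y ≠ 0 := by
    intro h0; exact hπ (by rw [h0, pair2_zero_right])
  refine ⟨π, ?_, Γ', ω 2, ω 3, h2, h3, hy0⟩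
  intro h0
  apply hx0
  rw [hE Γ Γ' h π c hcF, h0, map_zero]

/-- **Honesty, free form: (P♯₂) ⇒ (P♮₂)** over (I0)–(I2) only — so modulo the print structure the free obstruction is
EXACTLY gen 2's free pairing step. -/
theorem freeObstruction_of_freePairing2At (M : U.ModelAxioms) (hd : D.Decomp) (ho : D.Ortho) {K : CMField}
    {Ψ : Fin 4 → CMType K} {σ : K →+* ℂ} (hP : U.FreePairing2At V K Ψ σ) : D.FreeObstruction K Ψ σ := by
  classical
  intro Γ₀ Γ₁ ω₀ ω₁ h₀ h₁ hne₀ hne₁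
  have hH := M.pull_hodge
  obtain ⟨Γ', f₀, f₁, ω, e0, e1, h2, h3, hper⟩ := hP Γ₀ Γ₁ ω₀ ω₁ h₀ h₁ hne₀ hne₁
  rw [period_eq_pair2, e0, e1] at hper
  set x := U.cup2C _ 1 (U.pullC f₀ 1 ω₀) (U.pullC f₁ 1 ω₁) with hx_def
  set y := U.cup2C _ 1 (ω 2) (ω 3) with hy_def
  have hxF : x ∈ U.F2 Γ' :=
    cup2C_mem_F2' M.cup2_hodge _ (Uiso_le_H10 hH Γ' K (Ψ 0) σ (pullC_mem_Uiso M.pull_comp f₀ K (Ψ 0) σ h₀))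
      (Uiso_le_H10 hH Γ' K (Ψ 1) σ (pullC_mem_Uiso M.pull_comp f₁ K (Ψ 1) σ h₁))
  have hyF : y ∈ U.F2 Γ' :=
    cup2C_mem_F2' M.cup2_hodge _ (Uiso_le_H10 hH Γ' K (Ψ 2) σ h2) (Uiso_le_H10 hH Γ' K (Ψ 3) σ h3)
  obtain ⟨s, -, hsum⟩ := hd Γ' _ hxF
  have hper' : ∑ π ∈ s, U.pair2 _ (D.proj Γ' π x) (D.proj Γ' π y) ≠ 0 := by
    have : U.pair2 _ x y = ∑ π ∈ s, U.pair2 _ (D.proj Γ' π x) (D.proj Γ' π y) := by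
      conv_lhs => rw [hsum]
      rw [pair2_sum_left]
      exact Finset.sum_congr rfl fun π _ => pair2_proj_left hd ho Γ' π hxF hyF
    rw [← this]
    exact hper
  obtain ⟨π, -, hπ⟩ := Finset.exists_ne_zero_of_sum_ne_zero hper'
  have hx0 : D.proj Γ' π x ≠ 0 := by
    intro h0; exact hπ (by rw [h0, pair2_zero_left])
  have hy0 : D.proj Γ' π y ≠ 0 := by
    intro h0; exact hπ (by rw [h0, pair2_zero_right])
  exact ⟨Γ', f₀, f₁, π, hx0, Γ', ω 2, ω 3, h2, h3, hy0⟩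

/-- **(P♭) ⇒ (P♮)** (with the decomposition (I1)). -/
theorem obstruction_of_supportIncl (M : U.ModelAxioms) (hd : D.Decomp) {K : CMField} {Ψ : Fin 4 → CMType K}
    {σ : K →+* ℂ} (h : D.SupportIncl K Ψ σ) : D.Obstruction K Ψ σ := by
  intro Γ ω₀ ω₁ h₀ h₁ hne
  have hcF : U.cup2C _ 1 ω₀ ω₁ ∈ U.F2 Γ :=
    cup2C_mem_F2' M.cup2_hodge _ (Uiso_le_H10 M.pull_hodge Γ K (Ψ 0) σ h₀)
      (Uiso_le_H10 M.pull_hodge Γ K (Ψ 1) σ h₁)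
  obtain ⟨π, hπ⟩ := exists_proj_ne_zero hd Γ hcF hne
  exact ⟨π, hπ, h π ⟨Γ, ω₀, ω₁, h₀, h₁, hπ⟩⟩

/-- **(P) from the print-interface package (I0)–(I6) and the support inclusion (P♭).** -/
theorem pairingAt_of_supportIncl (M : U.ModelAxioms) (hS : D.Standard Hk) {K : CMField} {Ψ : Fin 4 → CMType K}
    {σ : K →+* ℂ} (h : D.SupportIncl K Ψ σ) : U.PairingAt V K Ψ σ :=
  D.pairingAt_of_obstruction M hS (D.obstruction_of_supportIncl M hS.decomp h)

end IsoDatum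

/-! ### Under the face and the PerL binders; the headline theorems -/

/-- **The isotypic pairing package for faces** (replaces `PairingFace`): for every Galois CM field `F` with
`[F:ℚ] ≥ 6`, face `f`, admissible `ι₁` and hermitian space `V`, an isotypic datum of the tower satisfying the
PRINT-INTERFACE package (I0)–(I6) and THE OBSTRUCTION (P♮) for the four types `f.psi` at `ι₁`. -/
def IsoPairingFace (Hk : U.HeckeData) : Prop :=
  ∀ (F : CMField), IsGalois ℚ F → 6 ≤ Module.finrank ℚ F →
    ∀ (f : Face F) (ι₁ : F →+* ℂ), f.Admissible ι₁ → ∀ V : HermSpace3 F ι₁,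
      ∃ D : U.IsoDatum V, D.Standard Hk ∧ D.Obstruction F f.psi ι₁

/-- The same under the PerL binders (PerL v5 Thm 4.4; replaces `PairingPerL`). -/
def IsoPairingPerL (Hk : U.HeckeData) : Prop :=
  ∀ (K L : CMField) (j : K →+* L), IsNormalClosure ℚ K L →
    Module.finrank ℚ K = 6 → (Module.finrank ℚ L = 24 ∨ Module.finrank ℚ L = 48) →
    ∀ (φ : Fin 3 → (K →+* ℂ)), IsFrame φ →
    ∀ (ι₁ : L →+* ℂ), ι₁.comp j = φ 0 →
    ∀ (t : Fin 4 → CMType K), IsPerLTypes φ t →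
    ∀ V : HermSpace3 L ι₁, ∃ D : U.IsoDatum V, D.Standard Hk ∧ D.Obstruction K t (φ 0)

variable {U} {Hk : U.HeckeData}

/-- (P) for faces from the isotypic package. -/
theorem pairingFace_of_iso (M : U.ModelAxioms) (h : U.IsoPairingFace Hk) : U.PairingFace := by
  intro F hG h6 f ι₁ hadm V
  obtain ⟨D, hS, hO⟩ := h F hG h6 f ι₁ hadm V
  exact D.pairingAt_of_obstruction M hS hO

/-- (P) under the PerL binders from the isotypic package. -/
theorem pairingPerL_of_iso (M : U.ModelAxioms) (h : U.IsoPairingPerL Hk) : U.PairingPerL := by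
  intro K L j hN hK hL φ hφ ι₁ hι t ht V
  obtain ⟨D, hS, hO⟩ := h K L j hN hK hL φ hφ ι₁ hι t ht V
  exact D.pairingAt_of_obstruction M hS hO

variable (U)

/-- **COR-CM with BOTH realisation inputs reduced** (headline of the lineage, gen 4): `HC_CM` from the 28 model facts,
(V) `Fact_virtualCup11₂` (PRINT: Venkataramana 2001 Thm 8, two-level reading), (S) `LiuSupplyFace` (PRINT [Liu21,
KS97, Rog90] ∧ the dictionary `Dict`, gen 3), (P) `IsoPairingFace Hk` (PRINT-INTERFACE (I0)–(I6) ∧ THE OBSTRUCTION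
(P♮)), Pohlmann, [QW8]+Milne. -/
theorem COR_CM_of_iso_pieces (M : U.ModelAxioms) (hV : U.Fact_virtualCup11₂) (hL : U.LiuSupplyFace)
    {Hk : U.HeckeData} (hI : U.IsoPairingFace Hk) (hPo : U.PohlmannSpan) (hQ : U.Qw8Sufficiency) : U.HC_CM :=
  COR_CM_of_liu_pieces U M hV hL (pairingFace_of_iso M hI) hPo hQ

/-- **PerL v5 Thm 4.4 with both realisation inputs reduced.** -/
theorem perL44_of_iso_pieces (M : U.ModelAxioms) (hV : U.Fact_virtualCup11₂) (hL : U.LiuSupplyPerL)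
    {Hk : U.HeckeData} (hI : U.IsoPairingPerL Hk) : U.PerL44 :=
  perL44_of_liu_pieces U M hV hL (pairingPerL_of_iso M hI)

/-- The same over the cruder supply input (S₀₁ᵉ) of gen 2 (no Liu datum). -/
theorem COR_CM_of_supply_iso (M : U.ModelAxioms) (hV : U.Fact_virtualCup11₂) (hS : U.TypeSupplyEach01Face)
    {Hk : U.HeckeData} (hI : U.IsoPairingFace Hk) (hPo : U.PohlmannSpan) (hQ : U.Qw8Sufficiency) : U.HC_CM :=
  COR_CM_of_pieces₂ U M hV hS (pairingFace_of_iso M hI) hPo hQ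

/-- PerL Thm 4.4 over the cruder supply input (S₀₁ᵉ) of gen 2. -/
theorem perL44_of_supply_iso (M : U.ModelAxioms) (hV : U.Fact_virtualCup11₂) (hS : U.TypeSupplyEach01PerL)
    {Hk : U.HeckeData} (hI : U.IsoPairingPerL Hk) : U.PerL44 :=
  perL44_of_pieces₂ U M hV hS (pairingPerL_of_iso M hI)

/-! ### The Venkataramana-free headline: supply (print ∧ Dict) + isotypic structure (print) + the free obstruction -/

/-- **The free isotypic package for faces**: (I0)–(I6) ∧ (P♮₂) for the four types of every admissible face. -/
def IsoFreeFace (Hk : U.HeckeData) : Prop :=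
  ∀ (F : CMField), IsGalois ℚ F → 6 ≤ Module.finrank ℚ F →
    ∀ (f : Face F) (ι₁ : F →+* ℂ), f.Admissible ι₁ → ∀ V : HermSpace3 F ι₁,
      ∃ D : U.IsoDatum V, D.Standard Hk ∧ D.FreeObstruction F f.psi ι₁

/-- The same under the PerL binders. -/
def IsoFreePerL (Hk : U.HeckeData) : Prop :=
  ∀ (K L : CMField) (j : K →+* L), IsNormalClosure ℚ K L →
    Module.finrank ℚ K = 6 → (Module.finrank ℚ L = 24 ∨ Module.finrank ℚ L = 48) →
    ∀ (φ : Fin 3 → (K →+* ℂ)), IsFrame φ →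
    ∀ (ι₁ : L →+* ℂ), ι₁.comp j = φ 0 →
    ∀ (t : Fin 4 → CMType K), IsPerLTypes φ t →
    ∀ V : HermSpace3 L ι₁, ∃ D : U.IsoDatum V, D.Standard Hk ∧ D.FreeObstruction K t (φ 0)

variable {U} {Hk : U.HeckeData}

/-- The (V)-route factors through the free package: (V₂) ∧ `IsoPairingFace` ⇒ `IsoFreeFace`. -/
theorem isoFreeFace_of_virtualCup_iso (M : U.ModelAxioms) (hV : U.Fact_virtualCup11₂) (h : U.IsoPairingFace Hk) :
    U.IsoFreeFace Hk := by
  intro F hG h6 f ι₁ hadm V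
  obtain ⟨D, hS, hO⟩ := h F hG h6 f ι₁ hadm V
  exact ⟨D, hS, D.freeObstruction_of_virtualCup_obstruction M.pull_comp (hV F ι₁ (by omega) V) hO⟩

/-- (Ported verbatim from the HodgeCMPerL package; no docstring in the source.) -/
theorem isoFreePerL_of_virtualCup_iso (M : U.ModelAxioms) (hV : U.Fact_virtualCup11₂) (h : U.IsoPairingPerL Hk) :
    U.IsoFreePerL Hk := by
  intro K L j hN hK hL φ hφ ι₁ hι t ht V
  obtain ⟨D, hS, hO⟩ := h K L j hN hK hL φ hφ ι₁ hι t ht V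
  have h4 : 4 ≤ Module.finrank ℚ L := by rcases hL with h | h <;> omega
  exact ⟨D, hS, D.freeObstruction_of_virtualCup_obstruction M.pull_comp (hV L ι₁ h4 V) hO⟩

/-- **rfwf Thm 4.1 (`PeriodThmF`) without Venkataramana**: the model facts, the Liu supply package (S), the free isotypic
package.  Assembly: `typeSupplyEach01Face_of_hom ∘ homSupplyEach01Face_of_liu` (gens 3, 2) and gen 2's
`periodNV_of_supplyEach01_freePairing2`. -/
theorem periodThmF_of_liu_isoFree (M : U.ModelAxioms) (hL : U.LiuSupplyFace) (hI : U.IsoFreeFace Hk) :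
    U.PeriodThmF := by
  intro F hG h6 f ι₁ hι V
  obtain ⟨D, hS, hO⟩ := hI F hG h6 f ι₁ hι V
  exact periodNV_of_supplyEach01_freePairing2 M.pull_comp
    (typeSupplyEach01Face_of_hom M.eigenLine M.alphaLine M.H1_rank (homSupplyEach01Face_of_liu hL) F hG h6 f ι₁ hι V)
    (D.freePairing2At_of_freeObstruction M hS hO)

/-- **PerL v5 Thm 4.4 without Venkataramana.** -/
theorem perL44_of_liu_isoFree (M : U.ModelAxioms) (hL : U.LiuSupplyPerL) (hI : U.IsoFreePerL Hk) : U.PerL44 := by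
  intro K L j hN hK hL24 φ hφ ι₁ hι t ht V
  obtain ⟨D, hS, hO⟩ := hI K L j hN hK hL24 φ hφ ι₁ hι t ht V
  exact periodNV_of_supplyEach01_freePairing2 M.pull_comp
    (typeSupplyEach01PerL_of_hom M.eigenLine M.alphaLine M.H1_rank (homSupplyEach01PerL_of_liu hL)
      K L j hN hK hL24 φ hφ ι₁ hι t ht V)
    (D.freePairing2At_of_freeObstruction M hS hO)

variable (U)

/-- **COR-CM, sharpest form of the lineage (gen 4)** — NO Venkataramana, NO realisation input: `HC_CM` from the 28 model
facts, (S) `LiuSupplyFace` = PRINT [Liu21 Thm 1.1/4.18, Prop 4.13, Lemma 4.17; KS97; Rog90 §15.3] ∧ the dictionary `Dict`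
(gen 3), (P) `IsoFreeFace Hk` = PRINT-INTERFACE (I0)–(I6) ∧ THE OBSTRUCTION (P♮₂), Pohlmann, [QW8]+Milne. -/
theorem COR_CM_of_liu_isoFree (M : U.ModelAxioms) (hL : U.LiuSupplyFace) {Hk : U.HeckeData}
    (hI : U.IsoFreeFace Hk) (hPo : U.PohlmannSpan) (hQ : U.Qw8Sufficiency) : U.HC_CM :=
  Assembly.hc_cm_of U
    (Assembly.w_rk4_of U (periodThmF_of_liu_isoFree M hL hI) (StubTree.prop22_surfaceCriterion U M)
      StubTree.landherr_exists M.pms_dim StubTree.admissible_exists)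
    (StubTree.faceReduction_holds U hPo hQ) (StubTree.lemma81_holds U M)

/-- **PerL (`W_per^L`) without Venkataramana.** -/
theorem perL_of_liu_isoFree (M : U.ModelAxioms) (hL : U.LiuSupplyPerL) {Hk : U.HeckeData}
    (hI : U.IsoFreePerL Hk) : U.PerL :=
  Assembly.perL_of_perL44 U StubTree.landherr_exists (perL44_of_liu_isoFree M hL hI)

end Universe

end HodgeCM

end
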